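import Summits.Ventures.YMGap.RobustBall.Defs
import HarnessLib

/-!
# RobustBall/LoopWords — lattice words and their holonomies: gauge covariance, locality, centre-slab rotations
(cell `pub-ymgap`, track Y2 ROBUST-BALL, T0.2 witnesses; p1)

HONEST FRAMING: elementary finite-torus bookkeeping for the membership certificates of concrete non-Wilson
members of the robust ball (`RobustBall/Defs`): nothing probabilistic, nothing about the continuum or a
Clay-sense mass gap.

A WORD is a list of letters `(site, dir, inv)`: the link `(site, dir)` traversed forward or backward. Its
holonomy `wordProd w U` is the ordered product of the link variables (inverted for backward letters). We prove,
for a general group `G`: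
* `wordProd_gaugeTransform` — along a WALK from `s` to `t` the holonomy is gauge covariant,
  `U^g ↦ g(s) · hol · g(t)⁻¹`; for a closed walk the real trace in `SU(N)` is gauge invariant;
* `dependsOn_wordProd` — the holonomy reads only the letters' links;
* `wordProd_centerSlabRotate` — multiplying the `v`-links at height `t` by a CENTRAL `z` multiplies the holonomy by
  `z ^ netCount` (signed number of such letters), so BALANCED words (`netCount = 0`) are centre-slab invariant;
* `mult w e` — the multiplicity of a link among the letters (the weight in the one-link Lipschitz bounds of
  `RobustBall/LoopActivity`, where the `SU(N)` estimates and the loop activity `τ(1 − Re tr U_w/N)` live).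
-/

noncomputable section

open MeasureTheory Finset Function
open Literature.Probability.LatticeModels Literature.Probability.LatticeModels.DobrushinMetric
open Literature.MathematicalPhysics.QuantumLattice hiding torusNorm
open Literature.MathematicalPhysics.QuantumFieldTheory hiding ZdEdge

namespace Summit.Ventures.YMGap.RobustBall

variable {d L : ℕ}

/-! ### Letters and words -/

/-- A letter of a lattice word: the positively oriented link `(site, dir)`, traversed forward (`inv = false`,
from `site` to `site + e_dir`) or backward (`inv = true`). [folklore] -/
@[ext] structure Letter (d L : ℕ) where
  /-- base point of the link -/
  site : Site d L
  /-- direction of the link -/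
  dir : Fin d
  /-- `true` if the link is traversed against its orientation -/
  inv : Bool

namespace Letter

variable (l : Letter d L)

/-- The link of a letter. [folklore] -/
def edge : Edge d L := (l.site, l.dir)

/-- The start point of a letter (as traversed). [folklore] -/
def src : Site d L := if l.inv then l.site.shift l.dir else l.site

/-- The end point of a letter (as traversed). [folklore] -/
def tgt : Site d L := if l.inv then l.site else l.site.shift l.dir

variable {G : Type*} [Group G]

/-- The group element carried by a letter: `U_e` or `U_e⁻¹`. [folklore] -/
def hol (U : GaugeConfig d L G) : G := if l.inv then (U l.edge)⁻¹ else U l.edge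

/-- `edge` of an explicit letter. [folklore] -/
@[simp] theorem edge_mk (x : Site d L) (k : Fin d) (b : Bool) : (Letter.mk x k b).edge = (x, k) := rfl

/-- Gauge covariance of a letter: `hol(U^g) = g(src) · hol(U) · g(tgt)⁻¹`. [folklore] -/
theorem hol_gaugeTransform (g : Site d L → G) (U : GaugeConfig d L G) :
    l.hol (gaugeTransform g U) = g l.src * l.hol U * (g l.tgt)⁻¹ := by
  rcases l with ⟨x, k, b⟩
  cases b <;> simp [hol, src, tgt, edge, gaugeTransform, mul_assoc]

/-- A letter reads only its own link. [folklore] -/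
theorem hol_congr {U V : GaugeConfig d L G} (h : U l.edge = V l.edge) : l.hol U = l.hol V := by
  simp [hol, h]

end Letter

variable {G : Type*} [Group G]

/-- The holonomy of a word: the ordered product of its letters. [folklore] -/
def wordProd : List (Letter d L) → GaugeConfig d L G → G
  | [], _ => 1
  | l :: w, U => l.hol U * wordProd w U

/-- `wordProd [] = 1`. [folklore] -/
@[simp] theorem wordProd_nil (U : GaugeConfig d L G) : wordProd ([] : List (Letter d L)) U = 1 := rfl

/-- `wordProd (l :: w) = hol l · wordProd w`. [folklore] -/
@[simp] theorem wordProd_cons (l : Letter d L) (w : List (Letter d L)) (U : GaugeConfig d L G) :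
    wordProd (l :: w) U = l.hol U * wordProd w U := rfl

/-- `wordProd` of a concatenation. [folklore] -/
theorem wordProd_append (w w' : List (Letter d L)) (U : GaugeConfig d L G) :
    wordProd (w ++ w') U = wordProd w U * wordProd w' U := by
  induction w with
  | nil => simp
  | cons l w ih => simp [ih, mul_assoc]

/-- `IsWalk s w t`: the letters of `w`, read in order, form a lattice walk from `s` to `t`. [folklore] -/
def IsWalk : Site d L → List (Letter d L) → Site d L → Prop
  | s, [], t => s = t
  | s, l :: w, t => l.src = s ∧ IsWalk l.tgt w t

/-- **Gauge covariance of word holonomies**: along a walk from `s` to `t`,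
`hol_w(U^g) = g(s) · hol_w(U) · g(t)⁻¹`. [folklore] -/
theorem wordProd_gaugeTransform {w : List (Letter d L)} {s t : Site d L} (hw : IsWalk s w t)
    (g : Site d L → G) (U : GaugeConfig d L G) :
    wordProd w (gaugeTransform g U) = g s * wordProd w U * (g t)⁻¹ := by
  induction w generalizing s with
  | nil =>
    cases hw
    simp
  | cons l w ih =>
    obtain ⟨hs, hw⟩ := hw
    subst hs
    rw [wordProd_cons, wordProd_cons, ih hw, Letter.hol_gaugeTransform]
    group

/-- The set of links read by a word. [folklore] -/
def wordEdges (w : List (Letter d L)) : Finset (Edge d L) := (w.map Letter.edge).toFinset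

/-- Membership in `wordEdges`. [folklore] -/
theorem mem_wordEdges {w : List (Letter d L)} {e : Edge d L} : e ∈ wordEdges w ↔ ∃ l ∈ w, l.edge = e := by
  simp [wordEdges]

/-- A word holonomy reads only the links of its letters. [folklore] -/
theorem wordProd_congr {w : List (Letter d L)} {U V : GaugeConfig d L G}
    (h : ∀ l ∈ w, U l.edge = V l.edge) : wordProd w U = wordProd w V := by
  induction w with
  | nil => rfl
  | cons l w ih =>
    rw [wordProd_cons, wordProd_cons, l.hol_congr (h l (by simp)), ih fun l' hl' => h l' (by simp [hl'])]

/-- `DependsOn` form of `wordProd_congr`. [folklore] -/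
theorem dependsOn_wordProd (w : List (Letter d L)) :
    DependsOn (fun U : GaugeConfig d L G => wordProd w U) (↑(wordEdges w) : Set (Edge d L)) :=
  fun _ _ h => wordProd_congr fun l hl => h _ (by exact_mod_cast mem_wordEdges.2 ⟨l, hl, rfl⟩)

/-- The MULTIPLICITY of the link `e` in the word `w` (number of letters reading `e`). [folklore] -/
def mult (w : List (Letter d L)) (e : Edge d L) : ℕ := (w.map Letter.edge).count e

/-- `mult [] = 0`. [folklore] -/
@[simp] theorem mult_nil (e : Edge d L) : mult ([] : List (Letter d L)) e = 0 := rfl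

/-- `mult (l :: w) e = mult w e + [l.edge = e]`. [folklore] -/
theorem mult_cons (l : Letter d L) (w : List (Letter d L)) (e : Edge d L) :
    mult (l :: w) e = mult w e + if l.edge = e then 1 else 0 := by
  simp [mult, List.count_cons, beq_iff_eq]

/-- A link of multiplicity `0` is not read. [folklore] -/
theorem mult_eq_zero_iff {w : List (Letter d L)} {e : Edge d L} : mult w e = 0 ↔ e ∉ wordEdges w := by
  simp [mult, wordEdges, List.count_eq_zero]

/-- `mult` as a sum over the letters' positions. [folklore] -/
theorem mult_eq_sum (w : List (Letter d L)) (e : Edge d L) :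
    mult w e = ((w.map Letter.edge).map fun e' => if e' = e then 1 else 0).sum := by
  induction w with
  | nil => rfl
  | cons l w ih => rw [mult_cons, ih]; simp [add_comm]

/-! ### Centre-slab rotations -/

section Centre

variable {N : ℕ}

/-- The signed number of letters of `w` in direction `v` at `v`-height `t` (`+1` forward, `−1` backward). [folklore] -/
def netCount (w : List (Letter d L)) (v : Fin d) (t : ZMod L) : ℤ :=
  (w.map fun l => if l.dir = v ∧ l.site v = t then (if l.inv then (-1 : ℤ) else 1) else 0).sum

/-- `netCount [] = 0`. [folklore] -/
@[simp] theorem netCount_nil (v : Fin d) (t : ZMod L) : netCount ([] : List (Letter d L)) v t = 0 := rfl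

/-- `netCount (l :: w)`. [folklore] -/
theorem netCount_cons (l : Letter d L) (w : List (Letter d L)) (v : Fin d) (t : ZMod L) :
    netCount (l :: w) v t =
      (if l.dir = v ∧ l.site v = t then (if l.inv then (-1 : ℤ) else 1) else 0) + netCount w v t := by
  simp [netCount]

/-- A letter under a centre-slab rotation by a central `z`: `hol ↦ z^{±[letter in the slab]} · hol`. [folklore] -/
theorem Letter.hol_centerSlabRotate (l : Letter d L) (v : Fin d) (t : ZMod L) {z : SUN N}
    (hz : z ∈ Subgroup.center (SUN N)) (U : GaugeConfig d L (SUN N)) :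
    l.hol (centerSlabRotate v t z U) =
      z ^ (if l.dir = v ∧ l.site v = t then (if l.inv then (-1 : ℤ) else 1) else 0) * l.hol U := by
  rcases l with ⟨x, k, b⟩
  simp only [Letter.hol, Letter.edge, centerSlabRotate]
  by_cases h : k = v ∧ x v = t
  · rw [if_pos h, if_pos h]
    cases b
    · simp
    · have hzi := Subgroup.mem_center_iff.1 (Subgroup.inv_mem _ hz)
      simp only [if_true, zpow_neg, zpow_one, mul_inv_rev]
      exact hzi _
  · rw [if_neg h, if_neg h]
    cases b <;> simp

/-- **Centre-slab rotation of a word holonomy**: for central `z`,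
`hol_w(z •_{v,t} U) = z ^ netCount_w(v,t) · hol_w(U)`. [folklore] -/
theorem wordProd_centerSlabRotate (w : List (Letter d L)) (v : Fin d) (t : ZMod L) {z : SUN N}
    (hz : z ∈ Subgroup.center (SUN N)) (U : GaugeConfig d L (SUN N)) :
    wordProd w (centerSlabRotate v t z U) = z ^ netCount w v t * wordProd w U := by
  induction w with
  | nil => simp
  | cons l w ih =>
    rw [wordProd_cons, wordProd_cons, ih, Letter.hol_centerSlabRotate l v t hz, netCount_cons, zpow_add]
    have hc : z ^ netCount w v t ∈ Subgroup.center (SUN N) := Subgroup.zpow_mem _ hz _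
    have hc' := Subgroup.mem_center_iff.1 hc (l.hol U)
    -- `(z^a h)(z^b P) = z^a z^b (h P)` by centrality of `z^b`
    rw [mul_assoc, ← mul_assoc (l.hol U), hc']
    simp only [mul_assoc]

/-- A BALANCED word (`netCount ≡ 0`) has centre-slab invariant holonomy. [folklore] -/
theorem wordProd_centerSlabRotate_of_balanced {w : List (Letter d L)} (hw : ∀ v t, netCount w v t = 0)
    (v : Fin d) (t : ZMod L) {z : SUN N} (hz : z ∈ Subgroup.center (SUN N)) (U : GaugeConfig d L (SUN N)) :
    wordProd w (centerSlabRotate v t z U) = wordProd w U := by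
  rw [wordProd_centerSlabRotate w v t hz, hw, zpow_zero, one_mul]

end Centre

end Summit.Ventures.YMGap.RobustBall

end
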